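import Summits.QuantumFields.BalabanUV.T4Continuum.Spine.NE1p.DressedTerminalWitnessReuse
import Summits.QuantumFields.BalabanUV.T4Continuum.Spine.NE1p.DressedStabilityOfAbsorptionRouteSchedules

/-!
# T⁴ programme, spine estimate NE1′ (node O3b/H2) — THE ℝ-STEP SEAM FIRES AT FUNCTION LEVEL, part 2 of 2 (W30.2): S3t's FROZEN
# CORNER, GENUINELY — W7's one-family function-level toy (`towerM`, W11r's integer-`L` data) carried by ONE spectator `wOp` step and
# then FROZEN: Dirac fluctuation laws and an unmoved functional from step 1 on, `Spec k :⇔ k = 0`, the dictionary `hfrz` LIVE at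
# every later step; the absorption-route face S3t APPLIED BY NAME (swarm witness «W30» of `t4/formal/NE1p/LEAVES.md`, DAG N29zi,
# sub-entry W30.2; INTENT HOME/CLAIMS.log l.16134, BOOKED typer R-T105 (vii) l.16189, owner GO l.16191) [decided toy]

Cell `pub-balaban`, sub-cell `t4`, BINDER-OWNERS row NE1′ (owner lineage t4-ne1p-p1; ROOT-C OF RECORD `DressedRootStrict.DressedStabilityStrict`
p216910, ROOT-B `DressedRootFam.DressedBudget` p211697, headline `DressedRoot.DressedStability` p211416); formalisation crew
`b2b-balaban-t4-ne1p-formalise-*`, seat `…-leaf-01` (gen 11).  ADDITIVE — imports leaf-02's W11r part 1 `Spine/NE1p/DressedTerminalWitnessReuse`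
(p216180; through it W5 ∕ W7's (leaf-03) `towerM` data `BM` ∕ `TM` ∕ `FnM` ∕ `𝒬M` ∕ `FnM_succ` ∕ `hQM` ∕ `relGauge_pairs` ∕ `hslM` ∕ `hDμM` ∕ `hz₁M` ∕
`hregM` and W11r's integer-`L` data `anchM` ∕ `compM` ∕ `SM` ∕ `SgM` ∕ `𝒬T` ∕ `hFnT` ∕ `hQT` ∕ `hδfT` ∕ `hrateT` ∕ `hβT` ∕ `habsM` ∕ `hneM` ∕ `hsupM` —
ALL BY NAME) and leaf-04's S3t `Spine/NE1p/DressedStabilityOfAbsorptionRouteSchedules` (p218687; through it S3l.1 p215263 and S3s-1's bridge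
p217391; its §1 frozen-step lemmas `wOp_dirac` ∕ `mem_bddClass_dirac` ∕ `aestronglyMeasurable_dirac` BY NAME) ONLY; modifies nothing;
nothing of W5 ∕ W7 ∕ W11r ∕ S3l.1 ∕ S3t restated.  Part 1 (W30.1) = `Spine/NE1p/DressedTowerWitnessPairRStep.lean` (p224471; the GENUINE
ℝ-seam on W13's two-family datum, S3t's SPECTATOR corner).  IMPORT BASE (typer R-T109 (i), «admissible»): the INTENT named W7's data with a
new tower `towerF`; this file uses W11r's INTEGER-`L` presentation `towerM` of the same W7 data BY NAME and builds NO new tower — S3t asks an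
integer blocking factor (`hLb : (Lb:ℝ) = L` for the anchoring), which W7's `LW = 6e³` is not; the frozen data (`FnF`, `lawF`) are the new
function-level instantiation ON that booking.

WHY.  S3t's step classification `Spec` ∕ `hBspec` ∕ `hEspec` ∕ `hfrz` (l.236 ∕ 238 ∕ 243 ∕ 351) types the owner's ruling F-2-ROUTE «a frozen
family is carried un-performed — identity step, `s = 0`» INSIDE the H2 step law: at a non-spectator step the dictionary is
`(μ, base, 𝒜) = (dirac 0, 1, 0)` and `hFn` reads `Fn′ = Fn` (S3t §1 `wOp_dirac` ∕ `frozen_step_identity`); the typing answer of record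
(R-T71 (ii)) is that NOTHING needs reconciling — an identity step meets the same slice law, the booked size being the RESPONSE to the
shrinking defect pairs.  W30.1 inhabits this classification in its spectator corner only (`Spec :≡ True`, `hfrz` vacuous).  THIS FILE
inhabits the FROZEN corner with a GENUINELY MIXED classification on a decided function-level toy: step `0` is W7's two-atom averaging
step (`Spec 0`), every later step is frozen BY CONSTRUCTION (`¬ Spec k` for `k ≥ 1`: law `dirac 0`, functional unmoved), and S3t's ENDs fire
with `hfrz` discharged by `rfl`-conjunctions at every `k ≥ 1` — the R-T71 (ii) answer EXERCISED IN KERNEL: the frozen functional still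
meets the booking convention `hsup` with the SAME booked sizes (its increments over the shrinking defect pairs are the live functional's).

CONTENTS.
* §1 THE FROZEN DATA on W7's booking `BM K` (one family born at scale 0; W11r's integer blocking factor `81 ≤ Lb ≤ 120`): `FnF K k′ k :=
  FnM K k′ (min k 1)` (the carried functional: W7's at steps 0 and 1, then UNMOVED), `lawF k := if k = 0 then flAt (atomW 1) else dirac 0`
  (ONE averaging law, then Dirac laws); records `FnF_frozen` (`FnF K k′ (k+1) = FnF K k′ k`, `k ≥ 1`), GENUINE `FnF_live` (the step-0 law
  MOVES the functional — W7's `FnM_one_ne_birth`) and `lawF_frozen_ne_live` (the laws differ: total mass 1 vs 2).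
* §2 THE BINDERS OF S3t ON THE FROZEN DATA [folklore]: `hslF` (births = W7's `hslM` at `k′ = 0`, absent generations `0`), `hFnF` (step 0 =
  W11r's `hFnT`, steps `k ≥ 1` = S3t's `wOp_dirac` — the identity), `h𝒢F` ∕ `hmeasF` (W7's two-atom class ∕ S3t's `mem_bddClass_dirac`),
  `hfrzF : ¬ k = 0 → lawF k = dirac 0 ∧ base₁ = 1 ∧ zeroExp = 0 ∧ 0 ≤ 0` (THE FROZEN DICTIONARY, LIVE), `hDμF` ∕ `relGauge_pairsF` (at the
  Dirac atom `0`: `hz₁M` ∕ the null direction `dirNull`), `hsupF` (the booking convention for the frozen functional = W11r's `hsupM`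
  through `incr_FnF`: increments do not see the freeze), `hQF` (the dictionary `𝒬T` UNCHANGED: `𝒬M` never depended on the step).
* §3 THE ℝ-SEAM DATUM on `BM K`, ABSORPTION-FREE (`absorbs ≡ ∅` — the genuine seam is W30.1's; here the degenerate corner, said so):
  `preF` ∕ `RsF Lb K`, `compVol_RsF`, `preBelowEnv_RsF` (EQUALITY by `rfl`), `absorbLaw_RsF` (= W11r's `habsM` BY NAME, `A = 0`), the pair
  `hfan_F` ∕ `hamp_F` at `vR·mB = 1·1`.
* §4 S3t FIRES WITH THE MIXED CLASSIFICATION `Spec k :⇔ k = 0`, for every integer `81 ≤ Lb ≤ 120`: the With-form END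
  `dressedStabilityWith_of_absorptionRouteSchedules` applied ONCE BY NAME (`hBspec` ∕ `hEspec` := W5 ∕ W7's zero-action lemmas at the
  spectator step, `hfrz := hfrzF` at every other step) — read as the theorem **`classAt_towerM_frozen : ClassAt (towerM.B p K) 1 (rhoOne Lb⁻²
  2 0 ½) Lb⁻³`** (new statement) and as `example`s for the With-form ∕ headline ∕ ROOT-B ∕ ROOT-C `DressedStabilityStrict towerM (Lb⁴)` (their
  STATEMENTS are W11r's ∕ W7's ∕ `DressedTerminalWitnessStrict`'s landed ones through S3l's live door — `dedup.landed`-protected; W11r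
  precedent l.133 ∕ l.141: what is checked is that S3t's ENDs elaborate on the frozen data); decided instance `Lb = 100`.

LIVE vs ≡ 0 (typer R-T56 (h) (2)).  LIVE: W7's positive sizes ∕ `lin` ∕ `gen`, the step-0 averaging law (EQUATION), the freeze from step 1
(EQUATION `FnF_frozen`, law `dirac 0` ≠ the live law), the MIXED classification (`Spec 0`, `¬ Spec (k+1)`), `hfrz`'s four conjuncts at every
frozen step, `hsup` over a bounded attained increment set, the dictionary `hQ` (EQUATION), `hcm` ∕ (w6) with equality (W11r).  DECLARED ≡ 0
∕ degenerate: `𝒜 ≡ 0`, `s ≡ 0`, `creg ≡ 0`, `rel = Eq`, `base ≡ 1`, `z₀ = z₁ = 0`, `q ≡ 0` (as in W7 ∕ W11r), and the ℝ-seam `absorbs ≡ ∅`,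
`A = 0` (§3; the genuine seam is W30.1's).

HONEST FRAMING (typer R-T105 (vii)(g) wording ADOPTED).  A DECIDED TOY ([folklore]; 0 sorry; 0 citations; no `def … : Prop` — the four
`def`s are toy DATA): the frozen steps are frozen BY CONSTRUCTION (the owner's «identity step, s = 0» typed on a toy), never «Bałaban's
frozen families»; `RStep` is row O3.E-iii-c's SHAPE `T4PreservedUnderR.RStep` (a Literature STRUCTURE — our typing of «preserved under 𝐑»,
not a printed theorem) and `preF` is DEFINED as the transported envelope — the seam's EQUALITY case; NOTHING of [Balaban1989LargeFieldII]
(1.65)–(1.79) ∕ pp. 388–391's 𝐑 ∕ 𝐓′ operations, met components, absorption or (1.102)'s un-performed terms is modelled or asserted;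
`Lb ∈ [81,120]` is W11r's toy integer window, a kernel consequence of `locCell` ∕ (w6) (k2), never «Bałaban's L»; F-6's rate `ψ = L⁻²` a
displayed wall (k3); discharges NO wall item; R-t4r2-Q2 NOT met thereby.  Headline (c4): «S3t's classification binders are inhabited in
their FROZEN corner on a decided toy with a genuinely mixed `Spec` — the absorption-route face FIRES with `hfrz` live; non-vacuity of
SHAPES only — NE1′ ⇐ the named binders, NOT proved, NOT printed; 0 binders instantiated on Bałaban's densities»; spine PROVED 0∕9.
Rung (B)+1 on ONE finite four-torus — NOT infinite volume, NOT a mass gap, NOT OS on ℝ⁴, NOT Clay, NOT summit progress.  HONEST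
DEPENDENCY: continuum YM on T⁴ ⇐ BetaPertH ∧ nine spine estimates (0/9 proved); BetaPertH ⇐ (D1) ∧ (D4) ∧ CAP+tail; G-an2-4 gates
asym, D1 and NE2/3/4.
-/

noncomputable section

namespace Summit.QuantumFields.BalabanUV.T4Continuum.NE1p.DressedFrozenStepWitness

open MeasureTheory Set Metric Finset
open scoped BigOperators
open Literature.MathematicalPhysics.QuantumFieldTheory.Balaban1983to89
open Literature.MathematicalPhysics.QuantumFieldTheory.Balaban1983to89.T4TermFormat
open Literature.MathematicalPhysics.QuantumFieldTheory.Balaban1983to89.T4TermFormat.Booking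
open Literature.MathematicalPhysics.QuantumFieldTheory.Balaban1983to89.T4FeltGeometry
open Literature.MathematicalPhysics.QuantumFieldTheory.Balaban1983to89.T4GatedBooking
open Literature.MathematicalPhysics.QuantumFieldTheory.Balaban1983to89.T4TrajectoryComparison
open Literature.MathematicalPhysics.QuantumFieldTheory.Balaban1983to89.T4TrajectoryModulus
open Literature.MathematicalPhysics.QuantumFieldTheory.Balaban1983to89.T4PreservedUnderR (RStep)
open T4TrajectoryModulus (bondBall bondBall_add_mem bondBall_latMove_add_mem bondBall_diam)
open T4BlockTransport (Fld NDir latMove latN Site norm_dir_le)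
open T4BirthChartTransport (GaugeInvariant BirthSlice RelGauge)
open T4TrajectoryDensity
open Summit.QuantumFields.BalabanUV.T4Continuum.T4TrajectoryDensityDressed
open Summit.QuantumFields.BalabanUV.T4Continuum.T4TrajectoryDensityWitness
open Summit.QuantumFields.BalabanUV.T4Continuum.NE1p.DressedRoot
open Summit.QuantumFields.BalabanUV.T4Continuum.NE1p.DressedUniformConstants
open Summit.QuantumFields.BalabanUV.T4Continuum.NE1p.DressedWindowScheduleWin
open Summit.QuantumFields.BalabanUV.T4Continuum.NE1p.DressedWindowScheduleModWin
open Summit.QuantumFields.BalabanUV.T4Continuum.NE1p.DressedAbsorptionWindow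
open Summit.QuantumFields.BalabanUV.T4Continuum.NE1p.DressedTowerWitness
open Summit.QuantumFields.BalabanUV.T4Continuum.NE1p.DressedTowerWitnessSlice
open Summit.QuantumFields.BalabanUV.T4Continuum.NE1p.DressedTransportAssembledModData
open Summit.QuantumFields.BalabanUV.T4Continuum.NE1p.DressedTerminalWitnessReuse
open Summit.QuantumFields.BalabanUV.T4Continuum.NE1p.DressedStabilityOfCanonicalRStepSliceWinSchedules
open Summit.QuantumFields.BalabanUV.T4Continuum.NE1p.DressedStabilityStrictOfCanonicalSliceWinSchedules (dressedStabilityStrict_of_cellWith)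
open Summit.QuantumFields.BalabanUV.T4Continuum.NE1p.DressedStabilityOfAbsorptionRouteSchedules

/-! ## §1 The frozen function-level data on W7's booking [decided toy] -/

/-- THE CARRIED FUNCTIONAL [decided toy]: W7's `FnM` at steps `0` and `1`, then UNMOVED — `FnF K k′ k = FnM K k′ (min k 1)`. [folklore] -/
def FnF (K : ℕ) (k' k : ℕ) (U : Fld 4 ℂ) : ℂ := FnM K k' (min k 1) U

/-- THE FLUCTUATION LAWS [decided toy]: step `0` is W7's two-atom law `δ_0 + δ_{z_1}` (a genuine averaging step), every later step the
Dirac law at the junk point `0` (the frozen dictionary's `μ = dirac 0`). [folklore] -/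
def lawF (k : ℕ) : Measure (Fld 4 ℂ) := if k = 0 then flAt (atomW 1) else Measure.dirac 0

/-- [folklore] At step `0`: W7's functional. -/
theorem FnF_zero (K k' : ℕ) : FnF K k' 0 = FnM K k' 0 := rfl

/-- [folklore] From step `1` on: W7's step-`1` functional. -/
theorem FnF_succ (K k' k : ℕ) : FnF K k' (k + 1) = FnM K k' 1 := by
  unfold FnF; rw [Nat.min_eq_right (Nat.le_add_left 1 k)]

/-- [folklore] The step-`0` law is the two-atom law. -/
theorem lawF_zero : lawF 0 = flAt (atomW 1) := if_pos rfl

/-- [folklore] Every later law is `dirac 0`. -/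
theorem lawF_succ (k : ℕ) : lawF (k + 1) = Measure.dirac 0 := if_neg (Nat.succ_ne_zero k)

/-- **THE FREEZE** [decided toy]: from step `1` on the carried functional does not move — `FnF K k′ (k+1) = FnF K k′ k` for `k ≥ 1`. [folklore] -/
theorem FnF_frozen (K k' : ℕ) {k : ℕ} (hk : 1 ≤ k) : FnF K k' (k + 1) = FnF K k' k := by
  obtain ⟨j, rfl⟩ := Nat.exists_eq_add_of_le' hk
  rw [FnF_succ, FnF_succ]

/-- **THE SPECTATOR STEP IS LIVE** [decided toy]: the step-`0` averaging MOVES the birth functional (W7's `FnM_one_ne_birth`). [folklore] -/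
theorem FnF_live (K : ℕ) : FnF K 0 1 ≠ FnF K 0 0 := FnM_one_ne_birth K

/-- **THE FROZEN LAWS DIFFER FROM THE LIVE ONE** [decided toy]: `dirac 0 ≠ δ_0 + δ_{z_1}` (total mass `1 ≠ 2`). [folklore] -/
theorem lawF_frozen_ne_live : lawF 1 ≠ lawF 0 := by
  intro h
  have h1 : lawF 1 Set.univ = lawF 0 Set.univ := by rw [h]
  rw [lawF_succ, lawF_zero, flAt, Measure.add_apply, Measure.dirac_apply_of_mem (Set.mem_univ _),
    Measure.dirac_apply_of_mem (Set.mem_univ _), one_add_one_eq_two] at h1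
  exact ENNReal.one_lt_two.ne h1

/-! ## §2 The binders of S3t on the frozen data [folklore] -/

/-- `hsl` (w1): births = W7's `hslM` at `k′ = 0` (`FnF K 0 0 = FnM K 0 0`); absent generations are `0` with bound `0`. [folklore] -/
theorem hslF (K : ℕ) (b : (BM K).Birth) (k' : ℕ) :
    BirthSlice (FnF K k' k') latMove latN (bondBall 4 (Wm.ρw k') : Set (Fld 4 ℂ)) 1 1 ((TM K).gen b k') := by
  cases k' with
  | zero => exact hslM K b 0
  | succ j =>
    intro U hU p hp hp1
    refine ⟨univ, ?_, fun t _ => ?_, fun _ _ => subset_univ _⟩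
    · simp only [FnF, FnM, Nat.succ_ne_zero, ↓reduceIte]; fun_prop
    · show ‖FnF K (j + 1) (j + 1) (latMove U p t)‖ ≤ (if j + 1 = 0 then aM K * (cM + 3) else 0)
      simp [FnF, FnM]

/-- **`hFn` — THE H2 STEP LAW AS AN EQUATION AT EVERY STEP** [decided toy]: step `0` is W7's weighted two-point law (W11r's `hFnT`); at every
step `k ≥ 1` the law is `dirac 0` and `wOp` is evaluation at `0` (S3t's `wOp_dirac`) — the functional is carried UNMOVED, which is exactly
what `FnF` does. [folklore] -/
theorem hFnF (K k' k : ℕ) (hk : k + 1 ≤ K) (U : Fld 4 ℂ) :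
    FnF K k' (k + 1) U = wOp (expWeight base₁ (zeroExp + 𝒬T K k)) (lawF k) 0 U (fun z => FnF K k' k (U + z)) := by
  cases k with
  | zero => exact hFnT K k' 0 hk U
  | succ j => rw [lawF_succ, wOp_dirac, add_zero, FnF_succ, FnF_succ]

/-- `h𝒢`: the translates are in the class `BddClass` of the step law — W7's two-atom class at step `0`, S3t's `mem_bddClass_dirac` after. [folklore] -/
theorem h𝒢F (K k' k : ℕ) (U : Fld 4 ℂ) : (fun z => FnF K k' k (U + z)) ∈ BddClass ℂ (lawF k) := by
  cases k with
  | zero => exact mem_bddClass_flAt _ _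
  | succ j => rw [lawF_succ]; exact mem_bddClass_dirac _ _

/-- `hmeas`: every translate is a.e.-strongly measurable for every step law. [folklore] -/
theorem hmeasF (K k'' k : ℕ) (U : Fld 4 ℂ) : AEStronglyMeasurable (fun z => FnF K k'' k (U + z)) (lawF k) := by
  cases k with
  | zero => exact aesm_flAt _ _
  | succ j => rw [lawF_succ]; exact aestronglyMeasurable_dirac _ _

/-- **`hfrz` — THE FROZEN DICTIONARY, LIVE** [decided toy]: at every non-spectator step (`¬ k = 0`) the law IS `dirac 0`, the base density
IS `1`, the action exponent IS `0` and the margin `s = 0` is nonnegative — S3t's `hfrz` conclusion by `rfl`-conjunctions. [folklore] -/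
theorem hfrzF {k : ℕ} (hk : ¬ k = 0) :
    lawF k = Measure.dirac 0 ∧ (base₁ : Fld 4 ℂ → ℝ) = (fun _ => 1) ∧ zeroExp = (fun _ _ => 0) ∧ (0 : ℝ) ≤ 0 :=
  ⟨if_neg hk, rfl, rfl, le_rfl⟩

/-- `hDμ`: every step law lives in the fluctuation domain `bondBall (σ k)` — W7's `hDμM` at step `0`, the atom `0` (`hz₁M`) after. [folklore] -/
theorem hDμF (k : ℕ) : ∀ᵐ z ∂lawF k, z ∈ (bondBall 4 (Wm.σ k) : Set (Fld 4 ℂ)) := by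
  cases k with
  | zero => exact hDμM 0
  | succ j => rw [lawF_succ, ae_dirac_eq]; exact hz₁M (j + 1)

/-- The fresh pairs for `hpairx`: W7's `relGauge_pairs` at step `0`; at a frozen step the Dirac atom `0` pairs with itself through the
null direction `dirNull` (declared bound `dfW k`). [folklore] -/
theorem relGauge_pairsF (k : ℕ) :
    ∀ᵐ z ∂lawF k, ∀ Y : Fld 4 ℂ, RelGauge (fun U U' : Fld 4 ℂ => U = U') latMove latN (Y + 0) (Y + z) (dfW k) := by
  cases k with
  | zero => exact relGauge_pairs 0
  | succ j =>
    rw [lawF_succ, ae_dirac_eq]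
    refine fun Y => ⟨dirNull (j + 1), dfW_pos (j + 1), le_rfl, ?_⟩
    show Y + 0 = latMove (Y + 0) (dirNull (j + 1)) 1
    rw [dirNull, latMove_fldDir_one, add_zero, add_zero]

/-- **INCREMENTS DO NOT SEE THE FREEZE** [folklore]: the frozen functional's increment over any pair equals the live functional's (both
are `a_K·(U₁ − U₀)₀₀` — the accumulated dressing cancels). -/
theorem incr_FnF (K k' k : ℕ) (U₀ U₁ : Fld 4 ℂ) : ‖FnF K k' k U₁ - FnF K k' k U₀‖ = ‖FnM K k' k U₁ - FnM K k' k U₀‖ := by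
  by_cases h : k' = 0
  · subst h
    simp only [FnF, FnM, ↓reduceIte]
    ring_nf
  · simp [FnF, FnM, h]

/-- **`hsup` — THE BOOKING CONVENTION FOR THE FROZEN FUNCTIONAL WITH THE SAME BOOKED SIZES** [folklore]: the realised-increment set of
`FnF` IS that of `FnM` (`incr_FnF`), so W11r's `hsupM` applies verbatim — the typing answer R-T71 (ii) in kernel: a frozen family's
booked size is still the response to the shrinking defect pairs. -/
theorem hsupF (K : ℕ) (b : (BM K).Birth) (k' k : ℕ) :
    (TM K).lin b k' k ≤ sSup {x : ℝ | ∃ U₀ ∈ (bondBall 4 (Wm.ρw k) : Set (Fld 4 ℂ)), ∃ U₁ : Fld 4 ℂ,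
      RelGauge (fun U U' : Fld 4 ℂ => U = U') latMove latN U₀ U₁ (defW (k + 1)) ∧
        x = ‖FnF K k' k U₁ - FnF K k' k U₀‖} := by
  simp only [incr_FnF]
  exact hsupM K b k' k

/-- **`hQ` — THE DICTIONARY UNCHANGED** [folklore]: W7's `𝒬M` never depended on the step, so the frozen functional meets the same
dictionary equation (W11r's `hQT` shape with `FnF`; above the cutoff `0 = ¼·Σ_∅`). -/
theorem hQF (K : ℕ) (b : (BM K).Birth) (k : ℕ) :
    (fun U z => 𝒬T K k U z - (fun (_ : Fld 4 ℂ) => (0 : ℂ)) U) =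
      fun U z => ((1 / 4 : ℝ) : ℂ) * ∑ p ∈ SgM K k b,
        (FnF K p.2 k (U + z) - FnF K p.2 k (U + (fun (_ : (BM K).Birth) (_ : ℕ) => (0 : Fld 4 ℂ)) b k)) := by
  by_cases hk : k ≤ K
  · rw [𝒬T_of_le hk, SgM_of_le hk]
    exact hQM K b (min k 1)
  · rw [𝒬T_of_not_le hk, SgM_of_not_le hk]
    funext U z
    simp [zeroExp]

/-! ## §3 The ℝ-seam datum on W7's booking — ABSORPTION-FREE (the degenerate corner; the genuine seam is W30.1's) [decided toy] -/

section Seam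

variable (Lb : ℕ)

/-- Pre-ℝ sizes [decided toy]: the transported envelope one step on at the rate `ρ = Lb⁻²·alphaCell ½` (the seam's EQUALITY case). [folklore] -/
def preF (K : ℕ) (b : (BM K).Birth) (k : ℕ) : ℝ :=
  ((Lb : ℝ) ^ 2)⁻¹ * alphaCell (1 / 2) * (TM K).envVar (4 * (1 / 2) / 1) (fun _ : ℕ => ((Lb : ℝ) ^ 2)⁻¹ * alphaCell (1 / 2)) b (k - 1)

/-- THE ℝ-SEAM DATUM, ABSORPTION-FREE [decided toy]: nobody absorbs anybody (one family), the component at the birth is W11r's one cube of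
scale `0`, the dressing's own size is W11r's `β = (LW⁻³)^K`. [folklore] -/
def RsF (K : ℕ) : RStep (BM K) where
  pre := preF Lb K
  pre_nonneg := fun b k => mul_nonneg (by have := alphaCell_pos (show (0:ℝ) ≤ 1 / 2 by norm_num); positivity)
    ((TM K).envVar_nonneg (by norm_num)
      (fun _ => by have := alphaCell_pos (show (0:ℝ) ≤ 1 / 2 by norm_num); positivity) b (k - 1))
  absorbs := fun _ => ∅
  absorbs_lt := fun _ _ h => absurd h (Finset.notMem_empty _)
  comp := fun b => compM K 0 b
  comp_scale := fun b q hq => hscaleM K 0 b q hq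
  absorbs_felt := fun _ _ h => absurd h (Finset.notMem_empty _)
  δ := fun _ => (LW⁻¹ ^ 3) ^ K
  δ_nonneg := fun _ => by have := LW_pos; positivity

/-- `hcv`: component volume `1` (W11r's `hvolM`). [folklore] -/
theorem compVol_RsF (K : ℕ) : (RsF Lb K).CompVol 1 := fun b => hvolM K 0 b

/-- `hpre` AS AN EQUALITY: `pre b (k+1) = ρ·envVar b k` by the definition of `preF`, for any gate. [folklore] -/
theorem preBelowEnv_RsF (K : ℕ) (Gate : ℕ → Prop) :
    (TM K).PreBelowEnv (RsF Lb K) (4 * (1 / 2) / 1) (fun _ : ℕ => ((Lb : ℝ) ^ 2)⁻¹ * alphaCell (1 / 2)) Gate := by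
  intro b k _ _ _
  show preF Lb K b (k + 1) ≤ _
  simp only [preF, Nat.add_sub_cancel, le_refl]

/-- `hlaw` WITH `A = 0`: the absorption law reduces to W11r's absorption-free birth identity `habsM` (`C·gen b 0 = β K 0`, EQUALITY). [folklore] -/
theorem absorbLaw_RsF (K : ℕ) : (TM K).AbsorbLaw (RsF Lb K) (4 * (1 / 2) / 1) (fun _ : ℕ => (LW⁻¹ ^ 3) ^ K) 0 := by
  intro b
  have h := habsM K (fun _ : ℕ => ((Lb : ℝ) ^ 2)⁻¹ * alphaCell (1 / 2)) (fun _ => True) b (Nat.zero_le _) (fun _ _ => trivial)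
  simpa using h

end Seam

/-- The fan-out at `vR·mB = 1·1` with `A = 0`: `0 < 1`. [arith] [folklore] -/
theorem hfan_F : fanout 0 (((1 : ℕ) : ℝ) * ((1 : ℕ) : ℝ)) (3 / 4) < 1 := by norm_num [fanout]

/-- The absorbed amplitude at `vR·mB = 1·1`: `1∕(1 − 0) = 1 ≤ A₀ = 1`. [arith] [folklore] -/
theorem hamp_F : absorbAmplitude 1 0 (((1 : ℕ) : ℝ) * ((1 : ℕ) : ℝ)) (3 / 4) ≤ 1 := by norm_num [absorbAmplitude, fanout]

/-! ## §4 S3t FIRES WITH THE MIXED CLASSIFICATION `Spec k :⇔ k = 0` at every integer `81 ≤ Lb ≤ 120` [decided toy] -/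

section Fires

variable (Lb : ℕ)

/-- The rate `rhoOne Lb⁻² 2 0 ½` is nonnegative (`rhoOne_nonneg` BY NAME). [arith] [folklore] -/
theorem rhoOne_int_nonneg : 0 ≤ rhoOne ((Lb : ℝ) ^ 2)⁻¹ (4 * (1 / 2) / 1) 0 (1 / 2) :=
  rhoOne_nonneg (by positivity) (by norm_num) le_rfl (by norm_num)

variable (h81 : 81 ≤ Lb) (h120 : Lb ≤ 120)
include h81 h120

/-- **THE PER-CUTOFF CLASS THROUGH THE ABSORPTION-ROUTE FACE WITH A GENUINELY FROZEN FAMILY** [decided toy]: for every `81 ≤ Lb ≤ 120`,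
`ClassAt (towerM.B p K) 1 (rhoOne Lb⁻² 2 0 ½) Lb⁻³` — the last conjunct of leaf-04's `dressedStabilityWith_of_absorptionRouteSchedules`
applied ONCE BY NAME on W7's booking with the FROZEN data of §1, the classification `Spec k :⇔ k = 0` (spectator `wOp` step at `0`
only: `hBspec` ∕ `hEspec` by W5's `realBaseAt_W` ∕ W7's `exponentSliceAt_M`), **`hfrz := hfrzF` at every `k ≥ 1`**, the ℝ-seam slots of
§3, W11r's anchoring ∕ housing ∕ rates ∕ scalars BY NAME (`hloc_int`, `hsmall_int`, …).  New statement; the END application lives in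
THIS proof term.  Non-vacuity of S3t's binder SHAPES with `hfrz` live; nothing of Bałaban's densities. [folklore] -/
theorem classAt_towerM_frozen (p : Unit) (K : ℕ) :
    ClassAt (towerM.B p K) 1 (rhoOne ((Lb : ℝ) ^ 2)⁻¹ (4 * (1 / 2) / 1) 0 (1 / 2)) ((Lb : ℝ)⁻¹ ^ 3) :=
  (dressedStabilityWith_of_absorptionRouteSchedules towerM (κ := 1 / 2) (L := (Lb : ℝ)) (cbar := 0) (N₀ := 1) (A₀ := 1)
    (sbar := 0) (ρ' := 3 / 4) (r := 1) (cδ := 1 / 2) (m := 1 / 4) (w := fun _ _ => 1) (fun _ _ => Wm) (by norm_num)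
    (Fn := fun _ K _ k' k => FnF K k' k) (rel := fun _ _ _ _ _ U U' => U = U') (ref := fun _ _ _ _ U => U)
    (base := fun _ _ _ _ => base₁) (𝒜 := fun _ _ _ _ => zeroExp) (𝒬 := fun _ K _ k => 𝒬T K k) (q := fun _ _ _ _ _ => 0)
    (μ := fun _ _ _ k => lawF k) (z₀ := fun _ _ _ _ => 0) (z₁ := fun _ _ _ _ => 0)
    (defect := fun _ _ _ _ k => defW (k + 1)) (s := fun _ _ _ _ => 0) (S := fun _ K k b => SM K k b)
    (Sg := fun _ K k b => SgM K k b) (c := fun _ _ _ _ => (((1 / 4 : ℝ)) : ℂ)) (δf := fun _ _ _ k _ => dfW k)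
    (creg := fun _ _ _ => 0) (Lb := Lb) (mB := 1) (v := 1) (vR := 1) (fun _ K => anchM K Lb)
    (comp := fun _ K k b => compM K k b) (fun _ K => RsF Lb K) (β := fun _ K _ => (LW⁻¹ ^ 3) ^ K) (A := 0) (β₀ := 1)
    (fun _ _ => hratioM) (one_le_natL h81) le_rfl zero_le_one zero_le_one (by norm_num) (hloc_int h81) hρ'_int hsmall_int
    one_pos (by norm_num)
    (fun _ K b k' _ _ _ => birthSlice_anti_window (hslF K b k') (Wm.hwcw k'))
    (fun _ K _ k' k _ _ hk _ U => hFnF K k' k hk U) (fun _ K _ k' k _ _ _ _ U => h𝒢F K k' k U)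
    (fun _ _ _ k => k = 0)
    (fun _ _ _ _ k _ _ _ _ hk => by subst hk; rw [lawF_zero]; exact realBaseAt_W _ _)
    (fun _ _ _ _ k _ _ _ _ hk => by subst hk; rw [lawF_zero]; exact exponentSliceAt_M _ _ _ _)
    (fun _ K b k x hx => hδfT h81 h120 K k b x hx) (fun _ _ _ k => hDμF k) (fun _ _ _ k => hz₁M k)
    (fun _ _ _ _ k _ _ _ _ U₀ _ pd _ _ => (relGauge_pairsF k).mono fun z hz t _ => hz (latMove U₀ pd t))
    (fun _ _ _ _ _ _ _ h => h ▸ rfl) (fun _ K _ _ k'' k U => hmeasF K k'' k U) (fun _ _ _ _ k => hdefwkM k)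
    (fun _ _ _ k' k _ _ _ => hrateT h81 h120 k' k) (fun _ _ _ _ k _ _ _ _ => hneM k)
    (fun _ K b k' k _ _ _ _ => hsupF K b k' k) (fun _ _ _ => le_rfl) (fun _ _ _ _ => le_rfl) (fun _ K => hregM K _)
    (fun _ _ _ _ => le_rfl) rfl (fun _ K => hmultM K Lb) (fun _ K => hscaleM K) (fun _ K => hhousedM K) (fun _ K => hvolM K)
    (fun _ K => compVol_RsF Lb K) (fun _ K => preBelowEnv_RsF Lb K _) (fun _ K => absorbLaw_RsF Lb K)
    (fun _ K j hj => hβT h81 h120 K j hj) (fun _ K b k => hQF K b k) (fun _ K => hSgT K) (fun _ _ _ _ => hcmM)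
    (fun _ _ _ k _ _ => hδfwkM k) hvN₀_int le_rfl hfan_F hamp_F (fun _ _ _ _ hk => hfrzF hk)).2.2.2.2 p K

/-- **S3t FIRES WITH `hfrz` LIVE — CONSTANTS DISPLAYED** [decided toy]: the With-form `DressedStabilityWith towerM 1 (rhoOne Lb⁻² 2 0 ½) Lb⁻³`
packaged from `classAt_towerM_frozen` and the signs of the displayed constants.  An `example`: the STATEMENT is W11r's landed
`dressedStabilityWith_towerM_integer` (S3l's live-family door, all steps live), protected by the gate's `dedup.landed` (W11r precedent);
what is new is the ROUTE — the absorption-route face with a frozen family. [folklore] -/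
example : DressedStabilityWith towerM 1 (rhoOne ((Lb : ℝ) ^ 2)⁻¹ (4 * (1 / 2) / 1) 0 (1 / 2)) ((Lb : ℝ)⁻¹ ^ 3) :=
  ⟨zero_le_one, rhoOne_int_nonneg Lb, by positivity,
    by have := one_le_natL h81; exact pow_le_one₀ (by positivity) (inv_le_one_of_one_le₀ this),
    classAt_towerM_frozen Lb h81 h120⟩

/-- **S3t FIRES — THE ROW ROOT `DressedStability towerM` LITERALLY**, frozen corner [decided toy] (an `example`: the statement is W7's landed
`dressedStability_towerM`). [folklore] -/
example : DressedStability towerM :=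
  ⟨_, _, _, zero_le_one, rhoOne_int_nonneg Lb, by positivity,
    by have := one_le_natL h81; exact pow_le_one₀ (by positivity) (inv_le_one_of_one_le₀ this),
    classAt_towerM_frozen Lb h81 h120⟩

/-- **S3t FIRES — ROOT-C OF RECORD `DressedStabilityStrict towerM (Lb⁴)`**, frozen corner [decided toy]: S3s-1's bridge over the With-form
(an `example`: the statement is `DressedTerminalWitnessStrict.dressedStabilityStrict_towerM_integer`'s, landed). [folklore] -/
example : DressedStabilityStrict towerM ((Lb : ℝ) ^ 4) :=
  dressedStabilityStrict_of_cellWith (one_le_natL h81) (hloc_int h81) hρ'_int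
    ⟨zero_le_one, rhoOne_int_nonneg Lb, by positivity,
      by have := one_le_natL h81; exact pow_le_one₀ (by positivity) (inv_le_one_of_one_le₀ this),
      classAt_towerM_frozen Lb h81 h120⟩

end Fires

/-- **DECIDED INSTANCE `Lb = 100`** [decided toy]: the per-cutoff class through the absorption-route face with the frozen family, at every
cutoff, with the displayed constants `(1, rhoOne 100⁻² 2 0 ½, 100⁻³)`. [folklore] -/
theorem classAt_towerM_frozen_hundred (p : Unit) (K : ℕ) :
    ClassAt (towerM.B p K) 1 (rhoOne (((100 : ℕ) : ℝ) ^ 2)⁻¹ (4 * (1 / 2) / 1) 0 (1 / 2)) (((100 : ℕ) : ℝ)⁻¹ ^ 3) :=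
  classAt_towerM_frozen 100 (by norm_num) (by norm_num) p K

/-- **THE CLASSIFICATION IS GENUINELY MIXED** [decided toy]: step `0` is a spectator step and no later step is; at every later step the
frozen dictionary holds (`hfrzF`), at step `0` it does NOT (the live law is not a Dirac law). [folklore] -/
theorem spec_mixed : (0 : ℕ) = 0 ∧ (∀ k : ℕ, ¬ k + 1 = 0) ∧ (∀ k : ℕ, lawF (k + 1) = Measure.dirac 0) ∧ lawF 0 ≠ Measure.dirac 0 :=
  ⟨rfl, Nat.succ_ne_zero, lawF_succ, fun h => lawF_frozen_ne_live ((lawF_succ 0).trans h.symm)⟩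

end Summit.QuantumFields.BalabanUV.T4Continuum.NE1p.DressedFrozenStepWitness

end
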